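import Literature.NumberTheory.EllipticCurves.KatoTwistedFiniteness
import HarnessLib

/-!
# Galois descent of Kato's `χ`-parts along `ℚ(ζ_m) ⊂ ℚ(ζ_M)`

`Literature/NumberTheory/EllipticCurves/KatoTwistedFiniteness.lean` vendors part (2) of
K. Kato, *`p`-adic Hodge theory and values of zeta functions of modular forms*, Astérisque 295
(2004), Cor. 14.3 (p. 235) — `L(E, χ, 1) ≠ 0 ⇒ E(K)^(χ)` finite — for `K = ℚ(ζ_m)`
(`kato_finite_chiPart_of_twistedLValue_ne_zero`, `m ≢ 2 (mod 4)`), and records as a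
`TODO(general form)` that the case of a subfield `K ⊂ ℚ(ζ_m)` follows by DESCENT: the natural
injection `E(K) → E(ℚ(ζ_m))` maps `E(K)^(χ)` into `E(ℚ(ζ_m))^(χ̃)` for the inflated character
`χ̃ = χ ∘ res`. This file proves that descent step, in general and along the cyclotomic tower:

* `map_mem_chiPart_of_equivariant`, `finite_chiPart_of_equivariant` — the algebra: for an
  additive map `ι : M → M'` intertwining operators `ρ (r g')` on `M` with `ρ' g'` on `M'` through
  ANY map of index sets `r : G' → G` (a restriction map of Galois groups, not necessarily a
  bijection) and characters `χ' = χ ∘ r`, `ι` maps `M^(χ)` into `M'^(χ')`; if `ι` is injective,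
  finiteness of `M'^(χ')` descends to `M^(χ)` (an element `∑ n_{g'} g'` of `I_{χ'}` pushes
  forward to `∑ n_{g'} r(g') ∈ I_χ`, acting on `ι x` as on `x`);
* `nonempty_algHom_cyclotomicField_of_dvd` — a `ℚ`-embedding `ι : ℚ(ζ_m) → ℚ(ζ_M)` for `m ∣ M`;
* `unitsMap_autEquivPow_eq_autEquivPow_restrictNormal` — the canonical isomorphisms
  `Gal(ℚ(ζ_n)/ℚ) ≅ (ℤ/n)ˣ`, `σ ↦ a` with `σζ = ζ^a` (Mathlib `IsCyclotomicExtension.autEquivPow`),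
  commute with restriction `Gal(ℚ(ζ_M)/ℚ) → Gal(ℚ(ζ_m)/ℚ)` and reduction `(ℤ/M)ˣ → (ℤ/m)ˣ`;
* `cyclotomicCharacterOf_changeLevel_eq_restrictNormal` — hence the character of
  `Gal(ℚ(ζ_M)/ℚ)` attached (`cyclotomicCharacterOf`) to the inflation `changeLevel χ` mod `M` of
  a Dirichlet character `χ` mod `m` is `σ ↦ χ(σ|_{ℚ(ζ_m)})`;
* `finite_chiPart_cyclotomic_of_dvd` — **descent**: for a Weierstrass curve `W/ℚ`, if the
  `χ̃`-part of `W(ℚ(ζ_M))` is finite then so is the `χ`-part of `W(ℚ(ζ_m))`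
  (`Point.map ι` is an injective equivariant homomorphism, Mathlib `Point.map_injective`,
  `Point.map_map`, `AlgEquiv.restrictNormal_commutes`);
* `ModularForms.twistedLSeries_changeLevel` — when `m` and `M` have the same prime divisors the
  inflation does not change the twisted series `∑ χ(n) aₙ n⁻ˢ` at all (Kato's
  `L_{prime(m)}(f, χ, s)`, §6.2 p. 161), so Kato's hypothesis is literally the same at both
  levels;
* `kato_finite_chiPart_subfield_of_twistedLValue_ne_zero` — Cor. 14.3 (2) for a subfield
  `K ⊂ ℚ(ζ_M)` given the embedding and a restriction map (the `TODO(general form)` of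
  `KatoTwistedFiniteness.lean` modulo Kronecker–Weber), from the vendored fact by
  `finite_chiPart_of_equivariant`;
* `kato_finite_chiPart_of_dvd_of_twistedLValue_ne_zero` — the assembled consequence of the
  vendored fact: for `m ∣ M`, `M ≢ 2 (mod 4)`, non-vanishing at `1` of (the continuation of)
  the mod-`M` series of `χ̃` already kills `E(ℚ(ζ_m))^(χ)`. With `M = 2m` for
  `m ≡ 2 (mod 4)` (same primes) this re-proves the all-moduli form (the statement of
  `kato_finite_chiPart_cyclotomic_of_twistedLValue_ne_zero_of`) from the least-modulus one; that
  equivalence is already in the tree (`KatoTwistedFinitenessProofs.lean`,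
  `kato_finite_chiPart_cyclotomic_iff`, by the different road `ℚ(ζ_{2d}) = ℚ(ζ_d)` and the Euler
  factor at `2`) and is not restated here.

## What is NOT here

* Kato's theorem itself (an Euler-system argument, Kato §§2–14 with Rubin's *Euler systems*):
  `kato_finite_chiPart_of_twistedLValue_ne_zero` stays a cited named fact.
* The general finite abelian `K/ℚ` of Cor. 14.3 needs, besides `finite_chiPart_of_equivariant`,
  an embedding `K ⊂ ℚ(ζ_m)` (Kronecker–Weber, not in Mathlib) to phrase `L(E, χ, s)` through a
  Dirichlet character; given such an embedding the descent is `finite_chiPart_of_equivariant`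
  with `r = restrictNormal`.

## References

* K. Kato, *`p`-adic Hodge theory and values of zeta functions of modular forms*, Astérisque 295
  (2004), 117–290: §6.2 (p. 161), Thm. 14.2, Cor. 14.3 and the remark between them (p. 235),
  §14.6 (p. 237: `Sel(K, T) = Sel(ℚ, T ⊗ ℤ[G])`, the Shapiro-type reduction this descent
  shadows on Mordell–Weil groups). [Kato2004Asterisque]
-/

noncomputable section

open scoped BigOperators

open WeierstrassCurve WeierstrassCurve.Affine CongruenceSubgroup Polynomial

namespace Literature.NumberTheory.EllipticCurves

/-! ### Descent of `χ`-parts along equivariant maps -/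

section Transport

variable {G G' M M' R : Type*} [AddCommGroup M] [AddCommGroup M'] [CommRing R]

/-- **Equivariant maps preserve `χ`-parts (general index maps).** Let `ι : M →+ M'`,
`r : G' → G` with `ρ'(g') ∘ ι = ι ∘ ρ(r g')` and `χ' = χ ∘ r`. Then `ι (M^(χ)) ⊂ M'^(χ')`: for
`a' = ∑ n_{g'} g'` with `∑ n_{g'} χ'(g') = 0`, the push-forward `r_* a' = ∑ n_{g'} r(g')` lies in
`I_χ` and `a' · ι(x) = ι (r_* a' · x) = 0`. (Compare `map_mem_chiPart` of
`KatoTwistedFinitenessProofs.lean`, the case of a bijection `G ≃ G'`.) [folklore] -/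
theorem map_mem_chiPart_of_equivariant {ρ : G → M →+ M} {ρ' : G' → M' →+ M'} {χ : G → R}
    {χ' : G' → R} (r : G' → G) (ι : M →+ M') (hρ : ∀ g' x, ρ' g' (ι x) = ι (ρ (r g') x))
    (hχ : ∀ g', χ' g' = χ (r g')) {x : M} (hx : x ∈ chiPart ρ χ) : ι x ∈ chiPart ρ' χ' := by
  classical
  intro a ha
  have key := hx (a.mapDomain r) (by
    rw [Finsupp.sum_mapDomain_index (h := fun g (n : ℤ) => (n : R) * χ g) (fun _ => by simp)
      (fun _ _ _ => by push_cast; ring)]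
    simpa only [hχ] using ha)
  rw [Finsupp.sum_mapDomain_index (h := fun g (n : ℤ) => n • ρ g x) (fun _ => zero_smul _ _)
    (fun _ _ _ => add_smul _ _ _)] at key
  calc (a.sum fun g n => n • ρ' g (ι x)) = a.sum fun g n => ι (n • ρ (r g) x) := by
        simp only [hρ, map_zsmul]
    _ = ι (a.sum fun g n => n • ρ (r g) x) := (map_finsuppSum ι a _).symm
    _ = 0 := by rw [key, map_zero]

/-- **Descent of finiteness of `χ`-parts along equivariant injections (general index maps).**
With `ι`, `r` as in `map_mem_chiPart_of_equivariant` and `ι` injective, `M^(χ)` is finite when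
`M'^(χ')` is. [folklore] -/
theorem finite_chiPart_of_equivariant {ρ : G → M →+ M} {ρ' : G' → M' →+ M'} {χ : G → R}
    {χ' : G' → R} (r : G' → G) (ι : M →+ M') (hι : Function.Injective ι)
    (hρ : ∀ g' x, ρ' g' (ι x) = ι (ρ (r g') x)) (hχ : ∀ g', χ' g' = χ (r g'))
    (hfin : Finite (chiPart ρ' χ')) : Finite (chiPart ρ χ) :=
  Finite.of_injective
    (fun x : chiPart ρ χ => (⟨ι x, map_mem_chiPart_of_equivariant r ι hρ hχ x.2⟩ : chiPart ρ' χ'))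
    fun _ _ hxy => Subtype.ext (hι (congrArg Subtype.val hxy))

end Transport

/-! ### `ℚ(ζ_m) ⊂ ℚ(ζ_M)` for `m ∣ M`: restriction of automorphisms versus `(ℤ/M)ˣ → (ℤ/m)ˣ` -/

section CyclotomicDescent

variable {m M : ℕ} [NeZero m] [NeZero M]

set_option backward.isDefEq.respectTransparency false in
/-- For `m ∣ M` there is a `ℚ`-embedding `ℚ(ζ_m) → ℚ(ζ_M)`: the `m`-th cyclotomic polynomial
splits in `ℚ(ζ_M)` (its roots are `M`-th roots of unity) and `ℚ(ζ_m)` is its splitting field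
(Mathlib `CyclotomicField`, `Polynomial.SplittingField.lift`). (As in `KatoTwistedFiniteness.lean`,
the option `backward.isDefEq.respectTransparency false` identifies the two `ℚ`-algebra structures
on `CyclotomicField n ℚ`.) [folklore] -/
theorem nonempty_algHom_cyclotomicField_of_dvd (hd : m ∣ M) :
    Nonempty (CyclotomicField m ℚ →ₐ[ℚ] CyclotomicField M ℚ) := by
  haveI : IsCyclotomicExtension ({M} ∪ {m}) ℚ (CyclotomicField M ℚ) :=
    IsCyclotomicExtension.of_union_of_dvd _ _ ⟨M, Set.mem_singleton M, NeZero.ne M, hd⟩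
  have hs : Splits ((cyclotomic m ℚ).map (algebraMap ℚ (CyclotomicField M ℚ))) :=
    IsCyclotomicExtension.splits_cyclotomic (S := ({M} ∪ {m} : Set ℕ)) ℚ (CyclotomicField M ℚ)
      (by simp)
  exact ⟨Polynomial.SplittingField.lift _ hs⟩

set_option backward.isDefEq.respectTransparency false in
/-- **Restriction and the canonical isomorphisms `Gal(ℚ(ζ_n)/ℚ) ≅ (ℤ/n)ˣ`.** For `m ∣ M`, an
embedding `ι : ℚ(ζ_m) → ℚ(ζ_M)` (making `ℚ(ζ_M)` a `ℚ(ζ_m)`-algebra) and `σ ∈ Gal(ℚ(ζ_M)/ℚ)` with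
`σ(μ) = μ^a` on `M`-th roots of unity (`a = autEquivPow σ ∈ (ℤ/M)ˣ`), the restriction
`σ|_{ℚ(ζ_m)}` raises `m`-th roots of unity to the power `a mod m`: `ι(ζ)` is a power of a
primitive `M`-th root `μ`, so `ι(σ|(ζ)) = σ(ι ζ) = (ι ζ)^a = ι(ζ^a)`. [folklore] -/
theorem unitsMap_autEquivPow_eq_autEquivPow_restrictNormal (hd : m ∣ M)
    (ι : CyclotomicField m ℚ →ₐ[ℚ] CyclotomicField M ℚ)
    (σ : CyclotomicField M ℚ ≃ₐ[ℚ] CyclotomicField M ℚ) :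
    letI : Algebra (CyclotomicField m ℚ) (CyclotomicField M ℚ) := ι.toRingHom.toAlgebra
    haveI : IsScalarTower ℚ (CyclotomicField m ℚ) (CyclotomicField M ℚ) :=
      IsScalarTower.of_algebraMap_eq fun x => (ι.commutes x).symm
    haveI : IsGalois ℚ (CyclotomicField m ℚ) := IsCyclotomicExtension.isGalois {m} ℚ _
    ZMod.unitsMap hd (IsCyclotomicExtension.autEquivPow (CyclotomicField M ℚ)
        (cyclotomic.irreducible_rat (NeZero.pos M)) σ) =
      IsCyclotomicExtension.autEquivPow (CyclotomicField m ℚ)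
        (cyclotomic.irreducible_rat (NeZero.pos m)) (σ.restrictNormal (CyclotomicField m ℚ)) := by
  letI : Algebra (CyclotomicField m ℚ) (CyclotomicField M ℚ) := ι.toRingHom.toAlgebra
  haveI : IsScalarTower ℚ (CyclotomicField m ℚ) (CyclotomicField M ℚ) :=
    IsScalarTower.of_algebraMap_eq fun x => (ι.commutes x).symm
  haveI : IsGalois ℚ (CyclotomicField m ℚ) := IsCyclotomicExtension.isGalois {m} ℚ _
  have hζ := IsCyclotomicExtension.zeta_spec m ℚ (CyclotomicField m ℚ)
  have hμ := IsCyclotomicExtension.zeta_spec M ℚ (CyclotomicField M ℚ)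
  set ζ := IsCyclotomicExtension.zeta m ℚ (CyclotomicField m ℚ)
  set μ := IsCyclotomicExtension.zeta M ℚ (CyclotomicField M ℚ)
  apply Units.ext
  rw [ZMod.unitsMap_val, IsCyclotomicExtension.autEquivPow_apply,
    IsCyclotomicExtension.autEquivPow_apply]
  set a := hμ.autToPow ℚ σ with ha
  set b := hζ.autToPow ℚ (σ.restrictNormal (CyclotomicField m ℚ)) with hb
  have hσμ : μ ^ (a : ZMod M).val = σ μ := hμ.autToPow_spec ℚ σ
  have hσζ : ζ ^ (b : ZMod m).val = σ.restrictNormal (CyclotomicField m ℚ) ζ := hζ.autToPow_spec ℚ _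
  -- `ι ζ` is an `M`-th root of unity, hence a power of the primitive `M`-th root `μ`
  have hιζ : (ι ζ) ^ M = 1 := by
    obtain ⟨c, rfl⟩ := hd
    rw [← map_pow, pow_mul, hζ.pow_eq_one, one_pow, map_one]
  obtain ⟨i, -, hi⟩ := hμ.eq_pow_of_pow_eq_one hιζ
  -- compute `σ (ι ζ)` in two ways
  have h1 : σ (ι ζ) = ι (ζ ^ (a : ZMod M).val) := by
    rw [← hi, map_pow, ← hσμ, ← pow_mul, mul_comm, pow_mul, hi, map_pow]
  have h2 : σ (ι ζ) = ι (ζ ^ (b : ZMod m).val) := by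
    rw [hσζ]
    exact (AlgEquiv.restrictNormal_commutes σ (CyclotomicField m ℚ) ζ).symm
  have h12 : ζ ^ (b : ZMod m).val = ζ ^ (a : ZMod M).val := ι.injective (h2.symm.trans h1)
  rw [(hζ.isOfFinOrder (NeZero.ne m)).pow_eq_pow_iff_modEq, ← hζ.eq_orderOf,
    ← ZMod.natCast_eq_natCast_iff] at h12
  simp only [MonoidHom.toFun_eq_coe]
  change ((hμ.autToPow ℚ σ : (ZMod M)ˣ) : ZMod M).cast =
    ((hζ.autToPow ℚ (σ.restrictNormal (CyclotomicField m ℚ)) : (ZMod m)ˣ) : ZMod m)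
  rw [ZMod.cast_eq_val, ← ha, ← hb, ← h12, ZMod.natCast_zmod_val]

set_option backward.isDefEq.respectTransparency false in
/-- **Inflated characters restrict.** For `m ∣ M`, `ι : ℚ(ζ_m) → ℚ(ζ_M)` and a Dirichlet
character `χ` mod `m` with inflation `χ̃ = changeLevel χ` mod `M`, the attached characters of the
Galois groups (`cyclotomicCharacterOf`) satisfy `χ̃(σ) = χ(σ|_{ℚ(ζ_m)})` for every
`σ ∈ Gal(ℚ(ζ_M)/ℚ)` (the image of `I_χ̃` under restriction is `I_χ`, cf. the `TODO(general form)`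
of `KatoTwistedFiniteness.lean`). [folklore] -/
theorem cyclotomicCharacterOf_changeLevel_eq_restrictNormal (hd : m ∣ M)
    (ι : CyclotomicField m ℚ →ₐ[ℚ] CyclotomicField M ℚ)
    (σ : CyclotomicField M ℚ ≃ₐ[ℚ] CyclotomicField M ℚ) (χ : DirichletCharacter ℂ m) :
    letI : Algebra (CyclotomicField m ℚ) (CyclotomicField M ℚ) := ι.toRingHom.toAlgebra
    haveI : IsScalarTower ℚ (CyclotomicField m ℚ) (CyclotomicField M ℚ) :=
      IsScalarTower.of_algebraMap_eq fun x => (ι.commutes x).symm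
    haveI : IsGalois ℚ (CyclotomicField m ℚ) := IsCyclotomicExtension.isGalois {m} ℚ _
    cyclotomicCharacterOf (DirichletCharacter.changeLevel hd χ) σ =
      cyclotomicCharacterOf χ (σ.restrictNormal (CyclotomicField m ℚ)) := by
  simp only [cyclotomicCharacterOf, MonoidHom.coe_comp, Function.comp_apply,
    MulEquiv.coe_toMonoidHom, DirichletCharacter.changeLevel_toUnitHom,
    ← unitsMap_autEquivPow_eq_autEquivPow_restrictNormal hd ι σ]

set_option backward.isDefEq.respectTransparency false in
open scoped Classical in
/-- **Galois descent of the finiteness of `χ`-parts of Mordell–Weil groups along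
`ℚ(ζ_m) ⊂ ℚ(ζ_M)`, `m ∣ M`.** For a Weierstrass curve `W/ℚ` and a Dirichlet character `χ` mod `m`
with inflation `χ̃` mod `M`: if the `χ̃`-part of `W(ℚ(ζ_M))` (Galois action `σ ↦ Point.map σ`,
character `cyclotomicCharacterOf χ̃`) is finite, so is the `χ`-part of `W(ℚ(ζ_m))` — the map
`Point.map ι : W(ℚ(ζ_m)) → W(ℚ(ζ_M))` of an embedding `ι` is an injective homomorphism
intertwining `σ` with `σ|_{ℚ(ζ_m)}`, and `χ̃(σ) = χ(σ|_{ℚ(ζ_m)})`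
(`finite_chiPart_of_equivariant`). This is the `TODO(general form)` step of
`KatoTwistedFiniteness.lean` inside the cyclotomic tower. [folklore] -/
theorem finite_chiPart_cyclotomic_of_dvd (hd : m ∣ M) (W : WeierstrassCurve ℚ)
    (χ : DirichletCharacter ℂ m)
    (hfin : Finite (chiPart
      (fun σ : CyclotomicField M ℚ ≃ₐ[ℚ] CyclotomicField M ℚ =>
        Point.map (W' := W.toAffine) (σ : CyclotomicField M ℚ →ₐ[ℚ] CyclotomicField M ℚ))
      (fun σ => (cyclotomicCharacterOf (DirichletCharacter.changeLevel hd χ) σ : ℂ)))) :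
    Finite (chiPart
      (fun σ : CyclotomicField m ℚ ≃ₐ[ℚ] CyclotomicField m ℚ =>
        Point.map (W' := W.toAffine) (σ : CyclotomicField m ℚ →ₐ[ℚ] CyclotomicField m ℚ))
      (fun σ => (cyclotomicCharacterOf χ σ : ℂ))) := by
  obtain ⟨ι⟩ := nonempty_algHom_cyclotomicField_of_dvd hd
  letI : Algebra (CyclotomicField m ℚ) (CyclotomicField M ℚ) := ι.toRingHom.toAlgebra
  haveI : IsScalarTower ℚ (CyclotomicField m ℚ) (CyclotomicField M ℚ) :=
    IsScalarTower.of_algebraMap_eq fun x => (ι.commutes x).symm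
  haveI : IsGalois ℚ (CyclotomicField m ℚ) := IsCyclotomicExtension.isGalois {m} ℚ _
  refine finite_chiPart_of_equivariant (fun σ => σ.restrictNormal (CyclotomicField m ℚ))
    (Point.map (W' := W.toAffine) ι) (Point.map_injective ι) (fun σ P => ?_) (fun σ => ?_) hfin
  · have hφ : (σ : CyclotomicField M ℚ →ₐ[ℚ] CyclotomicField M ℚ).comp ι =
        ι.comp (σ.restrictNormal (CyclotomicField m ℚ) :
          CyclotomicField m ℚ →ₐ[ℚ] CyclotomicField m ℚ) :=
      AlgHom.ext fun x => (AlgEquiv.restrictNormal_commutes σ (CyclotomicField m ℚ) x).symm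
    rw [Point.map_map, Point.map_map, hφ]
  · rw [cyclotomicCharacterOf_changeLevel_eq_restrictNormal hd ι σ χ]

end CyclotomicDescent

/-! ### Inflation to a level with the same primes does not change the twisted series -/

section LSeries

open ModularForms

variable {Γ : Subgroup (GL (Fin 2) ℝ)} {k : ℤ} {m M : ℕ} [NeZero M]

/-- If `m ∣ M` and every prime divisor of `M` divides `m`, inflating a Dirichlet character `χ`
mod `m` to `χ̃` mod `M` does not change the twisted series: `∑ χ̃(n) aₙ n⁻ˢ = ∑ χ(n) aₙ n⁻ˢ`
(`twistedLSeries`), because `χ̃(n) = χ(n)` for every `n` — both vanish exactly when `n` shares a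
prime with the level, and agree on units. In Kato's notation (Astérisque 295, §6.2, p. 161) both
are `L_{prime(m)}(f, χ, s)`. [folklore] -/
theorem ModularForms.twistedLSeries_changeLevel (hd : m ∣ M)
    (hp : ∀ p : ℕ, p.Prime → p ∣ M → p ∣ m) (f : CuspForm Γ k) (χ : DirichletCharacter ℂ m) :
    twistedLSeries f (DirichletCharacter.changeLevel hd χ) = twistedLSeries f χ := by
  funext s
  unfold twistedLSeries
  congr 1
  funext n
  congr 1
  by_cases hn : IsUnit ((n : ℕ) : ZMod M)
  · obtain ⟨u, hu⟩ := hn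
    rw [← hu, DirichletCharacter.changeLevel_eq_cast_of_dvd, hu, ZMod.cast_natCast hd]
  · rw [MulChar.map_nonunit _ hn, MulChar.map_nonunit]
    intro hn'
    apply hn
    rw [ZMod.isUnit_iff_coprime] at hn' ⊢
    refine Nat.Coprime.symm (Nat.coprime_of_dvd fun p hpp hpM hpn => ?_)
    have h1 : p ∣ 1 := by
      rw [← Nat.Coprime.gcd_eq_one hn']
      exact Nat.dvd_gcd hpn (hp p hpp hpM)
    exact hpp.ne_one (Nat.dvd_one.mp h1)

end LSeries

/-! ### Kato's corollary one level down the cyclotomic tower -/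

section Kato

open ModularForms

open scoped Classical in
/-- **Kato's Cor. 14.3 (2) below the top of a cyclotomic tower.** Assume the vendored fact
`kato_finite_chiPart_of_twistedLValue_ne_zero` (Kato, Astérisque 295, Cor. 14.3 (2), p. 235, for
`K = ℚ(ζ_M)`, `M ≢ 2 (mod 4)`). Let `m ∣ M`, `χ` a Dirichlet character mod `m` and `χ̃` its
inflation mod `M`. If the mod-`M` twisted series `∑ χ̃(n) aₙ(f) n⁻ˢ = L_{prime(M)}(f, χ, s)` has
an entire continuation not vanishing at `s = 1`, then the `χ`-part of `E(ℚ(ζ_m))` is finite: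
Kato gives `E(ℚ(ζ_M))^(χ̃)` finite and `finite_chiPart_cyclotomic_of_dvd` descends. When `m`
and `M` have the same primes the hypothesis is the level-`m` one
(`ModularForms.twistedLSeries_changeLevel`); e.g. `M = 2m` for `m ≡ 2 (mod 4)` recovers the
all-moduli form (`kato_finite_chiPart_cyclotomic_iff` in `KatoTwistedFinitenessProofs.lean`,
proved there by a different road). [cite: Kato2004Asterisque, Cor. 14.3 (2) (p. 235)] -/
theorem kato_finite_chiPart_of_dvd_of_twistedLValue_ne_zero
    (hK : kato_finite_chiPart_of_twistedLValue_ne_zero) (W : WeierstrassCurve ℚ) [W.IsElliptic]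
    {N : ℕ} [NeZero N] {f : CuspForm (Gamma0 N) 2} (hf : IsNewformOf W f) {m M : ℕ} [NeZero m]
    [NeZero M] (hd : m ∣ M) (hM : M % 4 ≠ 2) (χ : DirichletCharacter ℂ m)
    (hL : ∃ L : ℂ → ℂ, Differentiable ℂ L ∧
      (∀ s : ℂ, 2 < s.re → L s = twistedLSeries f (DirichletCharacter.changeLevel hd χ) s) ∧
      L 1 ≠ 0) :
    Finite (chiPart
      (fun σ : CyclotomicField m ℚ ≃ₐ[ℚ] CyclotomicField m ℚ =>
        Point.map (W' := W.toAffine) (σ : CyclotomicField m ℚ →ₐ[ℚ] CyclotomicField m ℚ))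
      (fun σ => (cyclotomicCharacterOf χ σ : ℂ))) :=
  finite_chiPart_cyclotomic_of_dvd hd W χ (hK W hf hM (DirichletCharacter.changeLevel hd χ) hL)

open scoped Classical in
/-- The case `M = 2m`, `2 ∣ m` of `kato_finite_chiPart_of_dvd_of_twistedLValue_ne_zero`, with the
hypothesis at level `m` itself (same primes, `ModularForms.twistedLSeries_changeLevel`): for
`m ≡ 2 (mod 4)` — where `m` is NOT the least modulus of `ℚ(ζ_m) = ℚ(ζ_{m/2})` — Kato's corollary
at level `2m ≡ 0 (mod 4)` still yields the finiteness of `E(ℚ(ζ_m))^(χ)` from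
`L_{prime(m)}(f, χ, 1) ≠ 0`. [cite: Kato2004Asterisque, Cor. 14.3 (2) (p. 235)] -/
theorem kato_finite_chiPart_of_two_dvd_of_twistedLValue_ne_zero
    (hK : kato_finite_chiPart_of_twistedLValue_ne_zero) (W : WeierstrassCurve ℚ) [W.IsElliptic]
    {N : ℕ} [NeZero N] {f : CuspForm (Gamma0 N) 2} (hf : IsNewformOf W f) {m : ℕ} [NeZero m]
    (hm : m % 4 = 2) (χ : DirichletCharacter ℂ m)
    (hL : ∃ L : ℂ → ℂ, Differentiable ℂ L ∧
      (∀ s : ℂ, 2 < s.re → L s = twistedLSeries f χ s) ∧ L 1 ≠ 0) :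
    Finite (chiPart
      (fun σ : CyclotomicField m ℚ ≃ₐ[ℚ] CyclotomicField m ℚ =>
        Point.map (W' := W.toAffine) (σ : CyclotomicField m ℚ →ₐ[ℚ] CyclotomicField m ℚ))
      (fun σ => (cyclotomicCharacterOf χ σ : ℂ))) := by
  have hd : m ∣ 2 * m := Dvd.intro_left 2 rfl
  have h2 : 2 ∣ m := by omega
  haveI : NeZero (2 * m) := ⟨by have := NeZero.ne m; omega⟩
  have hM : (2 * m) % 4 ≠ 2 := by omega
  have hp : ∀ p : ℕ, p.Prime → p ∣ 2 * m → p ∣ m := fun p hp hpM =>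
    (hp.dvd_mul.mp hpM).elim
      (fun h2' => (Nat.prime_dvd_prime_iff_eq hp Nat.prime_two).mp h2' ▸ h2) id
  refine kato_finite_chiPart_of_dvd_of_twistedLValue_ne_zero hK W hf hd hM χ ?_
  rw [twistedLSeries_changeLevel hd hp]
  exact hL

open scoped Classical in
/-- **Kato's Cor. 14.3 (2) for a subfield `K ⊂ ℚ(ζ_M)`** — the `TODO(general form)` of
`KatoTwistedFiniteness.lean`, granted an embedding (every finite abelian `K/ℚ` has one by
Kronecker–Weber, which is not in Mathlib). Data: `ι : K → ℚ(ζ_M)` (`M ≢ 2 (mod 4)`), a map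
`r : Gal(ℚ(ζ_M)/ℚ) → Aut(K/ℚ)` restricting automorphisms along `ι` (`σ ∘ ι = ι ∘ r σ`; for `K/ℚ`
normal, `r = AlgEquiv.restrictNormal`), a function `ψ` on `Aut(K/ℚ)` and a Dirichlet character
`χ` mod `M` inflating it (`χ(σ) = ψ(r σ)` through `cyclotomicCharacterOf`, i.e. `χ` is `ψ` viewed
on `(ℤ/M)ˣ ≅ Gal(ℚ(ζ_M)/ℚ) → Gal(K/ℚ)`, Kato p. 235). If the mod-`M` series
`∑ χ(n) aₙ(f) n⁻ˢ = L_{prime(M)}(f, ψ, s)` has an entire continuation with `L(1) ≠ 0`, then the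
`ψ`-part `E(K)^(ψ)` (action `τ ↦ Point.map τ`) is finite: the vendored fact gives
`E(ℚ(ζ_M))^(χ)` finite and `finite_chiPart_of_equivariant` descends along the injective
equivariant homomorphism `Point.map ι`. (Kato states the corollary with the least such `M`; the
statement here, for any admissible `M`, is its consequence through the vendored fact.)
[cite: Kato2004Asterisque, Cor. 14.3 (2) (p. 235)] -/
theorem kato_finite_chiPart_subfield_of_twistedLValue_ne_zero
    (hK : kato_finite_chiPart_of_twistedLValue_ne_zero) (W : WeierstrassCurve ℚ) [W.IsElliptic]
    {N : ℕ} [NeZero N] {f : CuspForm (Gamma0 N) 2} (hf : IsNewformOf W f) {M : ℕ} [NeZero M]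
    (hM : M % 4 ≠ 2) {K : Type*} [Field K] [Algebra ℚ K] (ι : K →ₐ[ℚ] CyclotomicField M ℚ)
    (r : (CyclotomicField M ℚ ≃ₐ[ℚ] CyclotomicField M ℚ) → (K ≃ₐ[ℚ] K))
    (hr : ∀ σ x, σ (ι x) = ι (r σ x)) (ψ : (K ≃ₐ[ℚ] K) → ℂ) (χ : DirichletCharacter ℂ M)
    (hψ : ∀ σ, (cyclotomicCharacterOf χ σ : ℂ) = ψ (r σ))
    (hL : ∃ L : ℂ → ℂ, Differentiable ℂ L ∧
      (∀ s : ℂ, 2 < s.re → L s = twistedLSeries f χ s) ∧ L 1 ≠ 0) :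
    Finite (chiPart (fun τ : K ≃ₐ[ℚ] K => Point.map (W' := W.toAffine) (τ : K →ₐ[ℚ] K)) ψ) := by
  refine finite_chiPart_of_equivariant r (Point.map (W' := W.toAffine) ι) (Point.map_injective ι)
    (fun σ P => ?_) hψ (hK W hf hM χ hL)
  have hφ : (σ : CyclotomicField M ℚ →ₐ[ℚ] CyclotomicField M ℚ).comp ι =
      ι.comp (r σ : K →ₐ[ℚ] K) :=
    AlgHom.ext fun x => hr σ x
  rw [Point.map_map, Point.map_map, hφ]

end Kato

end Literature.NumberTheory.EllipticCurves

end
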